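import Literature.AnabelianGeometry.SemiGraphs.HomComposition

/-!
# Composition of morphisms of semi-graphs of anabelioids — unit and associativity 2-cells ([SemiAnbd] §2, Rmk 2.4.2)

Mochizuki, *Semi-graphs of anabelioids*, Publ. RIMS **42** (2006), §2 Remark 2.4.2, author's
manuscript p.26 (kurims `paper:url-f33ace170ff4`). [cite: MochizukiSemiAnbd2006, Rmk 2.4.2, p. 26]

CONSTRUCTION ONLY (merge step M1/M2 of the L3 bridge, companion of `HomComposition.lean`): the
composition of 1-morphisms of semi-graphs of anabelioids defined there (`HomOver.comp`) is unital
and associative UP TO 2-ISOMORPHISM (`HomOver.Iso2` of `MorphismRigidity.lean`) — strictly so on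
the vertex and edge components (identity functors and re-bracketing of composites of pull-back
functors), the content being the coherence of the pasted 2-cells `φ_b`:

* `HomOver.idCompIso2 φ : Iso2 ((HomOver.id 𝒢).comp φ) φ`,
* `HomOver.compIdIso2 φ : Iso2 (φ.comp (HomOver.id ℋ)) φ`,
* `HomOver.assocIso2 φ ψ χ : Iso2 ((φ.comp ψ).comp χ) (φ.comp (ψ.comp χ))`.

(The underlying morphisms of semi-graphs compose strictly: `𝟙 ≫ f = f`, `(f ≫ g) ≫ k = f ≫ (g ≫ k)`
hold definitionally in `SemiGraph`, so both sides live over the same base.)  Together with the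
congruence `Iso2.hcomp` these are the data making isomorphism classes of 1-morphisms a category
(Rmk 2.4.2: "we may work with such morphisms as if they are simply morphisms in a category"); the
quotient category itself (objects restricted as in §4) is merge step M3.  Each coherence is proved
over an ARBITRARY presentation of the intermediate edges and then specialised, as in
`HomComposition.lean`.  No printed statement is (re-)typed here.
-/

namespace Literature.AnabelianGeometry.SemiGraphs

open CategoryTheory Literature.AnabelianGeometry.Anabelioids

universe v₁ u₁ u

/-- The pull-back functor of the identity morphism of an anabelioid is the identity functor
(dot-notation extension of `Anabelioids.Hom` of `Anabelioids/Basic.lean`, declared here with its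
absolute name). [cite: MochizukiSemiAnbd2006, Rmk 2.4.2, p. 26] -/
theorem _root_.Literature.AnabelianGeometry.Anabelioids.Hom.id_pullback (X : Type u₁)
    [Category.{v₁} X] : (Anabelioids.Hom.id X).pullback = 𝟭 X := rfl

namespace SemiGraphOfAnabelioids

variable {𝒢 ℋ 𝒦 ℒ : SemiGraphOfAnabelioids.{v₁, u₁, u}}
variable {f : 𝒢.graph ⟶ ℋ.graph} {g : ℋ.graph ⟶ 𝒦.graph} {k : 𝒦.graph ⟶ ℒ.graph}

/-! ### Left unit -/

/-- Coherence of the left unit 2-cell, over an arbitrary presentation of the image edge.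
[cite: MochizukiSemiAnbd2006, Rmk 2.4.2, p. 26] -/
theorem HomOver.id_comp_coh_aux (φ : HomOver 𝒢 ℋ f) {e : 𝒢.graph.Edge} {v : 𝒢.graph.Vertex}
    (pG : Anabelioids.Hom (𝒢.E e) (𝒢.V v)) (e₂ : ℋ.graph.Edge) (h₂ : f.edgeMap e = e₂)
    (pH : Anabelioids.Hom (ℋ.E e₂) (ℋ.V (f.vertexMap v)))
    (β : (φ.φV v).pullback ⋙ pG.pullback ≅ pH.pullback ⋙ (φ.φE e e₂ h₂).pullback) :
    (HomOver.id 𝒢).compCell φ pG e rfl pG e₂ h₂ pH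
        (pG.pullback.leftUnitor ≪≫ pG.pullback.rightUnitor.symm) β ≪≫
      Functor.isoWhiskerLeft pH.pullback (φ.φE e e₂ h₂).pullback.rightUnitor =
    Functor.isoWhiskerRight (φ.φV v).pullback.rightUnitor pG.pullback ≪≫ β := by
  subst h₂
  ext X
  simp only [Iso.trans_hom, NatTrans.comp_app, Functor.isoWhiskerLeft_hom, Functor.whiskerLeft_app,
    Functor.isoWhiskerRight_hom, Functor.whiskerRight_app, HomOver.compCell_hom_app,
    HomOver.compEIso_hom_app, Iso.symm_hom, Functor.leftUnitor_hom_app,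
    Functor.rightUnitor_inv_app, Functor.rightUnitor_hom_app]
  repeat (first
    | erw [eqToHom_refl]
    | erw [Functor.map_comp]
    | erw [CategoryTheory.Functor.map_id]
    | erw [Category.id_comp]
    | erw [Category.comp_id])
  rfl

/-- **Left unit 2-cell**: `id ∘ φ ≅ φ` in the category of 1-morphisms over `f` (= `𝟙 ≫ f`).
[cite: MochizukiSemiAnbd2006, Rmk 2.4.2, p. 26] -/
noncomputable def HomOver.idCompIso2 (φ : HomOver 𝒢 ℋ f) : HomOver.Iso2 ((HomOver.id 𝒢).comp φ) φ where
  isoV v := (φ.φV v).pullback.rightUnitor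
  isoE e e' h := (φ.φE e e' h).pullback.rightUnitor
  coh b v hb :=
    φ.id_comp_coh_aux (𝒢.pull b v hb) (ℋ.graph.edgeOf (f.branchMap b)) (f.edgeOf_branchMap b).symm
      (ℋ.pull (f.branchMap b) (f.vertexMap v) (f.abuts_branchMap b v hb)) (φ.φB b v hb)

/-! ### Right unit -/

/-- The edge components of `φ ∘ id` and of `φ` agree (transport along `f e = e'`, the identity
at the canonical presentation). [cite: MochizukiSemiAnbd2006, Rmk 2.4.2, p. 26] -/
noncomputable def HomOver.compIdIsoE (φ : HomOver 𝒢 ℋ f) (e : 𝒢.graph.Edge) (e' : ℋ.graph.Edge)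
    (h : f.edgeMap e = e') : (φ.compE (HomOver.id ℋ) e e' h).pullback ≅ (φ.φE e e' h).pullback := by
  subst h; exact (φ.φE e (f.edgeMap e) rfl).pullback.leftUnitor

/-- At the canonical presentation `compIdIsoE` is the left unitor. [cite: MochizukiSemiAnbd2006, Rmk 2.4.2, p. 26] -/
@[simp] theorem HomOver.compIdIsoE_rfl (φ : HomOver 𝒢 ℋ f) (e : 𝒢.graph.Edge) :
    φ.compIdIsoE e (f.edgeMap e) rfl = (φ.φE e (f.edgeMap e) rfl).pullback.leftUnitor := rfl

/-- Coherence of the right unit 2-cell, over an arbitrary presentation of the image edge.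
[cite: MochizukiSemiAnbd2006, Rmk 2.4.2, p. 26] -/
theorem HomOver.comp_id_coh_aux (φ : HomOver 𝒢 ℋ f) {e : 𝒢.graph.Edge} {v : 𝒢.graph.Vertex}
    (pG : Anabelioids.Hom (𝒢.E e) (𝒢.V v)) (e₁ : ℋ.graph.Edge) (h₁ : f.edgeMap e = e₁)
    (pH : Anabelioids.Hom (ℋ.E e₁) (ℋ.V (f.vertexMap v)))
    (α : (φ.φV v).pullback ⋙ pG.pullback ≅ pH.pullback ⋙ (φ.φE e e₁ h₁).pullback) :
    φ.compCell (HomOver.id ℋ) pG e₁ h₁ pH e₁ rfl pH α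
        (pH.pullback.leftUnitor ≪≫ pH.pullback.rightUnitor.symm) ≪≫
      Functor.isoWhiskerLeft pH.pullback (φ.compIdIsoE e e₁ h₁) =
    Functor.isoWhiskerRight (φ.φV v).pullback.leftUnitor pG.pullback ≪≫ α := by
  subst h₁
  ext X
  simp only [Iso.trans_hom, NatTrans.comp_app, Functor.isoWhiskerLeft_hom, Functor.whiskerLeft_app,
    Functor.isoWhiskerRight_hom, Functor.whiskerRight_app, HomOver.compCell_hom_app,
    HomOver.compEIso_hom_app, HomOver.compIdIsoE_rfl, Iso.symm_hom, Functor.leftUnitor_hom_app,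
    Functor.rightUnitor_inv_app]
  repeat (first
    | erw [eqToHom_refl]
    | erw [Functor.map_comp]
    | erw [CategoryTheory.Functor.map_id]
    | erw [Category.id_comp]
    | erw [Category.comp_id])
  rfl

/-- **Right unit 2-cell**: `φ ∘ id ≅ φ` over `f` (= `f ≫ 𝟙`). [cite: MochizukiSemiAnbd2006, Rmk 2.4.2, p. 26] -/
noncomputable def HomOver.compIdIso2 (φ : HomOver 𝒢 ℋ f) : HomOver.Iso2 (φ.comp (HomOver.id ℋ)) φ where
  isoV v := (φ.φV v).pullback.leftUnitor
  isoE e e' h := φ.compIdIsoE e e' h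
  coh b v hb :=
    φ.comp_id_coh_aux (𝒢.pull b v hb) (ℋ.graph.edgeOf (f.branchMap b)) (f.edgeOf_branchMap b).symm
      (ℋ.pull (f.branchMap b) (f.vertexMap v) (f.abuts_branchMap b v hb)) (φ.φB b v hb)

/-! ### Associativity -/

/-- Vertex components of `(χ ∘ ψ) ∘ φ` and `χ ∘ (ψ ∘ φ)`: re-bracketing of pull-back functors.
[cite: MochizukiSemiAnbd2006, Rmk 2.4.2, p. 26] -/
noncomputable def HomOver.assocIsoV (φ : HomOver 𝒢 ℋ f) (ψ : HomOver ℋ 𝒦 g) (χ : HomOver 𝒦 ℒ k)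
    (v : 𝒢.graph.Vertex) :
    (((φ.comp ψ).comp χ).φV v).pullback ≅ ((φ.comp (ψ.comp χ)).φV v).pullback :=
  (Functor.associator _ _ _).symm

/-- Edge components of `(χ ∘ ψ) ∘ φ` and `χ ∘ (ψ ∘ φ)`: re-bracketing of pull-back functors.
[cite: MochizukiSemiAnbd2006, Rmk 2.4.2, p. 26] -/
noncomputable def HomOver.assocIsoE (φ : HomOver 𝒢 ℋ f) (ψ : HomOver ℋ 𝒦 g) (χ : HomOver 𝒦 ℒ k)
    (e : 𝒢.graph.Edge) (e₃ : ℒ.graph.Edge) (h : ((f ≫ g) ≫ k).edgeMap e = e₃) :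
    (((φ.comp ψ).comp χ).φE e e₃ h).pullback ≅ ((φ.comp (ψ.comp χ)).φE e e₃ h).pullback :=
  (Functor.associator _ _ _).symm

/-- Coherence of the associativity 2-cell, over arbitrary presentations of the two intermediate
edges. [cite: MochizukiSemiAnbd2006, Rmk 2.4.2, p. 26] -/
theorem HomOver.assoc_coh_aux (φ : HomOver 𝒢 ℋ f) (ψ : HomOver ℋ 𝒦 g) (χ : HomOver 𝒦 ℒ k)
    {e : 𝒢.graph.Edge} {v : 𝒢.graph.Vertex} (pG : Anabelioids.Hom (𝒢.E e) (𝒢.V v))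
    (E₁ : ℋ.graph.Edge) (q₁ : f.edgeMap e = E₁)
    (pH : Anabelioids.Hom (ℋ.E E₁) (ℋ.V (f.vertexMap v)))
    (E₂ : 𝒦.graph.Edge) (q₂ : g.edgeMap E₁ = E₂) (Q₁₂ : (f ≫ g).edgeMap e = E₂)
    (pK : Anabelioids.Hom (𝒦.E E₂) (𝒦.V (g.vertexMap (f.vertexMap v))))
    (E₃ : ℒ.graph.Edge) (q₃ : k.edgeMap E₂ = E₃) (Q₂₃ : (g ≫ k).edgeMap E₁ = E₃)
    (Q : ((f ≫ g) ≫ k).edgeMap e = E₃)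
    (pL : Anabelioids.Hom (ℒ.E E₃) (ℒ.V (k.vertexMap (g.vertexMap (f.vertexMap v)))))
    (α : (φ.φV v).pullback ⋙ pG.pullback ≅ pH.pullback ⋙ (φ.φE e E₁ q₁).pullback)
    (β : (ψ.φV (f.vertexMap v)).pullback ⋙ pH.pullback ≅ pK.pullback ⋙ (ψ.φE E₁ E₂ q₂).pullback)
    (γ : (χ.φV (g.vertexMap (f.vertexMap v))).pullback ⋙ pK.pullback ≅
      pL.pullback ⋙ (χ.φE E₂ E₃ q₃).pullback) :
    (φ.comp ψ).compCell χ pG E₂ Q₁₂ pK E₃ q₃ pL (φ.compCell ψ pG E₁ q₁ pH E₂ q₂ pK α β) γ ≪≫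
        Functor.isoWhiskerLeft pL.pullback (HomOver.assocIsoE φ ψ χ e E₃ Q) =
      Functor.isoWhiskerRight (HomOver.assocIsoV φ ψ χ v) pG.pullback ≪≫
        φ.compCell (ψ.comp χ) pG E₁ q₁ pH E₃ Q₂₃ pL α (ψ.compCell χ pH E₂ q₂ pK E₃ q₃ pL β γ) := by
  subst q₁; subst q₂; subst q₃
  ext X
  simp only [Iso.trans_hom, NatTrans.comp_app, Functor.isoWhiskerLeft_hom, Functor.whiskerLeft_app,
    Functor.isoWhiskerRight_hom, Functor.whiskerRight_app, HomOver.compCell_hom_app,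
    HomOver.compEIso_hom_app, HomOver.assocIsoE, HomOver.assocIsoV, Iso.symm_hom,
    Functor.associator_inv_app]
  repeat (first
    | erw [eqToHom_refl]
    | erw [Functor.map_comp]
    | erw [CategoryTheory.Functor.map_id]
    | erw [Category.id_comp]
    | erw [Category.comp_id])
  repeat erw [Category.assoc]
  rfl

/-- **Associativity 2-cell**: `(χ ∘ ψ) ∘ φ ≅ χ ∘ (ψ ∘ φ)` over `(f ≫ g) ≫ k` (= `f ≫ (g ≫ k)`).
[cite: MochizukiSemiAnbd2006, Rmk 2.4.2, p. 26] -/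
noncomputable def HomOver.assocIso2 (φ : HomOver 𝒢 ℋ f) (ψ : HomOver ℋ 𝒦 g) (χ : HomOver 𝒦 ℒ k) :
    HomOver.Iso2 ((φ.comp ψ).comp χ) (φ.comp (ψ.comp χ)) where
  isoV v := HomOver.assocIsoV φ ψ χ v
  isoE e e₃ h := HomOver.assocIsoE φ ψ χ e e₃ h
  coh b v hb :=
    HomOver.assoc_coh_aux φ ψ χ (𝒢.pull b v hb)
      (ℋ.graph.edgeOf (f.branchMap b)) (f.edgeOf_branchMap b).symm
      (ℋ.pull (f.branchMap b) (f.vertexMap v) (f.abuts_branchMap b v hb))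
      (𝒦.graph.edgeOf (g.branchMap (f.branchMap b))) (g.edgeOf_branchMap (f.branchMap b)).symm
      ((f ≫ g).edgeOf_branchMap b).symm
      (𝒦.pull (g.branchMap (f.branchMap b)) (g.vertexMap (f.vertexMap v))
        (g.abuts_branchMap _ _ (f.abuts_branchMap b v hb)))
      (ℒ.graph.edgeOf (k.branchMap (g.branchMap (f.branchMap b))))
      (k.edgeOf_branchMap (g.branchMap (f.branchMap b))).symm
      ((g ≫ k).edgeOf_branchMap (f.branchMap b)).symm
      (((f ≫ g) ≫ k).edgeOf_branchMap b).symm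
      (ℒ.pull (k.branchMap (g.branchMap (f.branchMap b))) (k.vertexMap (g.vertexMap (f.vertexMap v)))
        (k.abuts_branchMap _ _ (g.abuts_branchMap _ _ (f.abuts_branchMap b v hb))))
      (φ.φB b v hb) (ψ.φB (f.branchMap b) (f.vertexMap v) (f.abuts_branchMap b v hb))
      (χ.φB (g.branchMap (f.branchMap b)) (g.vertexMap (f.vertexMap v))
        (g.abuts_branchMap _ _ (f.abuts_branchMap b v hb)))

end SemiGraphOfAnabelioids

end Literature.AnabelianGeometry.SemiGraphs
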